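import Summits.ABC.IUTFork.Thm311RealIsmDHMoverAssembledSharp
import Summits.ABC.IUTFork.Cor312PilotIdelesCapstone
import Summits.ABC.IUTFork.Cor312PinnedRegionsThreePins
import HarnessLib

/-!
# [IUTchIII] Cor. 3.12 — PR-1's Θ-PIN at the SHARP ASSEMBLED REAL SETTING: a kernel NEGATIVE under DH's (Ind2)

PROOF-ONLY file (0 definitions, 0 named facts; abc-iut cell, WAVE-4 prover seat abc-iut-w4-d087, gen 4; support piece
«NEG-PIN-REAL-SHARP» for the §D frame qualifier and the branch-C certificate design, answering abc-iut-L6-t24's census «no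
kernel object ties `PinnedRegions3` to the assembled REAL settings»). TAKES NO SIDE on [IUTchIII] Cor. 3.12.

THE PIN (PR-1, abc-iut-w5-d230, `Cor312PinnedRegions`): `ThetaPinned S P ρ` := (hρ) the region-forming operator `ρ`
transforms with the bad-place data under EVERY `Φ ∈ ⟨(Ind1) ∪ (Ind2)⟩`, `Φ` acting on the data through the star packets
(`LogShells.starAut Φ v`, `v ∈ V^bad`), and (pΘ) `P.thetaRegion m = ρ ((S.col P.n).frobΨ m)` ([IUTchIII] Cor. 3.12
p. 173 l. 46 – p. 174 l. 3; Thm. 3.11 (i) p. 154 l. 67–69). §1 (pure algebra, any situation/setting/`ρ`): a `Φ` acting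
TRIVIALLY on every bad-place star packet fixes `Ψ`, hence by (hρ)+(pΘ) FIXES every Θ-region `P.thetaRegion m j v_ℚ`.

THE SHARP REAL SETTING (abc-iut-c312-3 `Real.settingDHVolSharp`: abc-iut-c312-5's real Dupuy–Hilado-level situation with
the verbatim volumes, Θ-boxes read off ideles — `ι_j(t_{Θ,j,v_j})·(R_I)^∼` at `j ≥ 1`, the unit box `(R_I)^∼` at the
label `0` (`labelIdele … 0 = 1`) — analytic logarithms). At a tame quadratically ramified place `v₀` over `p₀ ≥ 5`
Dupuy–Hilado's (Ind2) family `Real.ismDH` (bicontinuous `ℚ`-linear `φ` with `φ(I_v) = I_v`) contains abc-iut-w5-d216's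
RAMIFIED MOVER (`IsmDHMover.exists_swap_parity`, p421508/p422813), a lattice automorphism of `I_{v₀} = ϖ⁻¹·𝒪_{v₀}`
moving the unit ball. §2: the one-place generator `Φ₀` (mover at `v₀`, identity elsewhere — w5-d216's
`factorwise ∘ summandwise` family, p427624) is the identity on every star packet over a rational place `≠ p₀` and MOVES
the label-`0` Θ-region at `(0, p₀)` = `e⁻¹(Π_{v⃗} (R_I)^∼)` (test vectors `⊗(z at v₀, 1 elsewhere)`, membership read at
the constant tuple as `‖z‖ ≤ 1`). §3 MAIN: if `F` has such a `v₀` with NO place of `S` over `p₀`, then for EVERY `ρ`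
(and `qK`, any columns `col`, ideles, context binders) `¬ ThetaPinned`, `¬ PinnedRegions`, `¬ PinnedRegions3` at
`settingDHVolSharp` (`not_thetaPinned_settingDHVolSharp` &c.).

READING (neutral): at our sharp real instantiation, under DH's (Ind2), print's Θ-pin is not instantiable by idele-box
regions — the raw unit box at a good tamely ramified packet is not (Ind2)-stable while (hρ) forces stability there; the
(Ind2)-STABLE readings (log-shell lattice boxes `Π c·I_{v⃗}`, abc-iut-c312-5 `family_image_latticePk`; the
"(4.10)-bounded" reading) are the pin-compatible ones, and under the ISOMETRY reading of Ism the mover is absent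
(abc-iut-c312-14 `Cor312IdentifiedIndFixes` §2). Branch C: a certificate binding `hPin : PinnedRegions(3)` AT
`settingDHVolSharp` has a jointly UNSATISFIABLE hypothesis group at every such `F` (vacuity guard). HONEST SCOPE: OUR
interface + OUR sharp real container under ONE reading of (Ind2); nothing bears on print's (xi-e)/(xi-f). [claim: Mochizuki2012,
status: disputed]; [cite: DupuyHilado2025, §3.9, §4.7, §4.9]; [cite: ScholzeStix2018, §2.2 pp. 9–10]. Consumed BY NAME. typed ≠ proved.
-/

noncomputable section

open Metric Set
open scoped Pointwise

namespace Summit.ABC.IUTFork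
/-! ## §1. The algebra of the Θ-pin: star-trivial indeterminacies fix every Θ-region -/
namespace Cor312Vol

open Thm311 Cor312

variable {T : ThetaIndex} {S : LatticeSituation T} {P : Cor312.Setting S.toSituation}
  {ρ : (∀ v : T.V, v ∈ T.Vbad → Set (S.L.StarPacket v)) → ∀ (j : T.Label) (vQ : T.VQ), Set (S.L.Packet j vQ)}

/-- **Under PR-1's Θ-pin, an indeterminacy acting trivially on the bad-place star packets FIXES every Θ-region.**
From (hρ) at `Ψ := (S.col P.n).frobΨ m` — where `Φ·Ψ = Ψ` — and (pΘ). Holds for every situation, setting and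
region-forming operator `ρ`. [claim: Mochizuki2012, status: disputed] -/
theorem image_thetaRegion_eq_of_thetaPinned (h : ThetaPinned S P ρ) {Φ : S.L.PacketAut}
    (hΦ : Φ ∈ Subgroup.closure (S.L.Ind1Family ∪ S.L.Ind2Family))
    (hstar : ∀ (v : T.V) (hv : v ∈ T.Vbad) (A : Set (S.L.StarPacket v)), S.L.starAut Φ v '' A = A)
    (m : ℤ) (j : T.Label) (vQ : T.VQ) : Φ j vQ '' P.thetaRegion m j vQ = P.thetaRegion m j vQ := by
  have h1 := h.1 Φ hΦ ((S.col P.n).frobΨ m) j vQ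
  have h2 : (fun (v : T.V) (hv : v ∈ T.Vbad) => S.L.starAut Φ v '' (S.col P.n).frobΨ m v hv) =
      (S.col P.n).frobΨ m := by
    funext v hv
    exact hstar v hv _
  rw [h2, ← h.2 m j vQ] at h1
  exact h1.symm

/-- Hence: if some `Φ ∈ ⟨(Ind1) ∪ (Ind2)⟩` acts trivially on the bad-place star packets but MOVES one Θ-region, the
Θ-pin fails for EVERY `ρ` (and so do `PinnedRegions`, `PinnedRegions3` for every `qK`). [claim: Mochizuki2012, status: disputed] -/
theorem not_thetaPinned_of_moves {Φ : S.L.PacketAut}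
    (hΦ : Φ ∈ Subgroup.closure (S.L.Ind1Family ∪ S.L.Ind2Family))
    (hstar : ∀ (v : T.V) (hv : v ∈ T.Vbad) (A : Set (S.L.StarPacket v)), S.L.starAut Φ v '' A = A)
    {m : ℤ} {j : T.Label} {vQ : T.VQ} (hmov : Φ j vQ '' P.thetaRegion m j vQ ≠ P.thetaRegion m j vQ)
    (ρ : (∀ v : T.V, v ∈ T.Vbad → Set (S.L.StarPacket v)) → ∀ (j : T.Label) (vQ : T.VQ), Set (S.L.Packet j vQ)) :
    ¬ ThetaPinned S P ρ := fun h =>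
  hmov (image_thetaRegion_eq_of_thetaPinned h hΦ hstar m j vQ)

end Cor312Vol

/-! ## §2. The one-place Dupuy–Hilado mover at the sharp real setting -/
namespace Thm311.Real

open Cor312 Cor312Vol Literature.IUT.LogThetaLattice Literature.IUT.LogVolume
  Literature.NumberTheory.NumberFields Literature.NumberTheory.GaloisRepresentations.Ultrametric
  NumberField IsDedekindDomain

section Assembled

variable {F : Type} [Field F] [NumberField F] (X : PilotData F)
  (M : Type) [Field M] [NumberField M]
  (archPk : ∀ (j : (thetaIndex X).Label) (vQ : (thetaIndex X).VQ),
    Set ((logShellsDH X (analyticLogv F)).Packet j vQ))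
  (archSub : ∀ (j : (thetaIndex X).Label) (v : (thetaIndex X).V),
    Set ((logShellsDH X (analyticLogv F)).Packet j ((thetaIndex X).over v)))
  (Ψ : ℤ → ∀ v : (thetaIndex X).V, v ∈ (thetaIndex X).Vbad → Set ((logShellsDH X (analyticLogv F)).StarPacket v))
  (act : ℤ → ∀ v : (thetaIndex X).V, v ∈ (thetaIndex X).Vbad →
    (logShellsDH X (analyticLogv F)).StarPacket v →
      Module.End ℚ ((logShellsDH X (analyticLogv F)).StarPacket v))
  (Mmod : ℤ → ∀ j : (thetaIndex X).LabelStar, Set ((logShellsDH X (analyticLogv F)).GlobalPacket j.1))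
  (region : ℤ → ∀ j : (thetaIndex X).LabelStar, FinDivisor M → ∀ vQ : (thetaIndex X).VQ,
    Set ((logShellsDH X (analyticLogv F)).Packet j.1 vQ))
  (n : ℤ) {HT : Type} {LogLink : HT → HT → Type} {IsFull : ∀ {s t : HT}, LogLink s t → Prop}
  (lat : LGPGaussianLogThetaLattice LogLink IsFull)
  {Frd : Type} {IsoF : Frd → Frd → Type} {Ob : Frd → Type} {realify : Frd → Frd} {Strip : Type}
  {IsoS : Strip → Strip → Type} {Mv : ∀ v : (thetaIndex X).V, v ∈ (thetaIndex X).Vbad → Type}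
  [∀ v h, Monoid (Mv v h)]
  (sig : GlobalLGPFrobenioidSignature (thetaIndex X).lstar (thetaIndex X).V (· ∈ (thetaIndex X).Vbad)
    Frd IsoF Ob realify Strip IsoS Mv)
  (split : SplittingMonoids Mv) {ObΔ : Type} {N : ∀ v : (thetaIndex X).V, v ∈ (thetaIndex X).Vbad → Type}
  [∀ v h, Monoid (N v h)] (qData : QPilotData ObΔ N)
  (tq : ∀ (pp : Nat.Primes) (x : (thetaIndex X).Fibre (.inr pp)),
    haveI : Fact (pp : ℕ).Prime := ⟨pp.2⟩; kOf X pp.1 x)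
  (t : ∀ (pp : Nat.Primes) (_ : Fin X.lstar) (x : (thetaIndex X).Fibre (.inr pp)),
    haveI : Fact (pp : ℕ).Prime := ⟨pp.2⟩; kOf X pp.1 x)
  (htq0 : ∀ pp x, tq pp x ≠ 0)
  (htq1 : ∀ (pp : Nat.Primes) (x : (thetaIndex X).Fibre (.inr pp)),
    haveI : Fact (pp : ℕ).Prime := ⟨pp.2⟩; placeOf X pp.1 x ∉ X.S → ‖tq pp x‖ = 1)

/-- At the label `0` the sharp Θ-idele is `1` (no Θ-pilot component there; Dupuy–Hilado §3.9 "`𝒪_{v⃗}` in the other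
degrees"). [cite: DupuyHilado2025, §3.9] -/
theorem labelIdele_zero (pp : Nat.Primes) (x : (thetaIndex X).Fibre (.inr pp)) :
    labelIdele X t pp 0 x = 1 := by
  unfold labelIdele
  rw [dif_neg]
  simp

/-- **THE ONE-PLACE DUPUY–HILADO MOVER at the sharp assembled real setting.** At a tame quadratically ramified place
`v₀` over `p₀ ≥ 5` there is `Φ₀ ∈ (Ind2)` of abc-iut-c312-5's Dupuy–Hilado-level signature `logShellsDH X (analyticLogv F)`
(the mover at `v₀`, the identity at every other place) which (a) is the IDENTITY on every star packet over a
rational place `≠ p₀`, and (b) MOVES the label-`0` Θ-region of `Real.settingDHVolSharp` at `(0, p₀)` — the preimage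
`e⁻¹(Π_{v⃗} (R_I)^∼)` of the unit boxes — for every Kummer index `m`.
[cite: DupuyHilado2025, §3.9, §4.9] [claim: Mochizuki2012, status: disputed] -/
theorem exists_ind2_starTrivial_moves_thetaRegion_zero_settingDHVolSharp
    (pp : Nat.Primes) (h5 : 5 ≤ (pp : ℕ)) (v₀ : HeightOneSpectrum (𝓞 F))
    (hv₀ : (thetaIndex X).over (.inr v₀) = .inr pp)
    (he : v₀.asIdeal.ramificationIdx ℤ = 2) (hf : v₀.asIdeal.inertiaDeg ℤ = 1) :
    ∃ Φ₀ ∈ (logShellsDH X (analyticLogv F)).Ind2Family,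
      (∀ v : (thetaIndex X).V, (thetaIndex X).over v ≠ .inr pp →
        (logShellsDH X (analyticLogv F)).starAut Φ₀ v = LinearEquiv.refl ℚ _) ∧
      ∀ m : ℤ, ⇑(Φ₀ 0 (.inr pp)) ''
          (settingDHVolSharp X (logvAnalytic_analyticLogv (F := F)) M archPk archSub Ψ act Mmod region n lat sig
            split qData tq t htq0 htq1).thetaRegion m 0 (.inr pp) ≠
        (settingDHVolSharp X (logvAnalytic_analyticLogv (F := F)) M archPk archSub Ψ act Mmod region n lat sig
            split qData tq t htq0 htq1).thetaRegion m 0 (.inr pp) := by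
  classical
  haveI hpF : Fact (pp : ℕ).Prime := ⟨pp.2⟩
  haveI : Fintype ((thetaIndex X).Fibre (.inr pp)) := Fintype.ofFinite _
  set K := kOf X pp.1 ⟨.inr v₀, hv₀⟩
  have hlog : LogvAnalytic (analyticLogv F) := logvAnalytic_analyticLogv (F := F)
  let L := logShellsDH X (analyticLogv F)
  set x₀ : (thetaIndex X).Fibre (.inr pp) := ⟨.inr v₀, hv₀⟩
  set P := presAt X hlog pp
  have hlab : (((0 : (thetaIndex X).Label)) : ℕ) = 0 := Fin.val_zero _
  have hres : residueChar F v₀ = (pp : ℕ) := congrArg Subtype.val (Sum.inr.inj hv₀)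
  -- the rescaled completion at `v₀`, a norm uniformizer `ϖ` with `‖ϖ‖² = p⁻¹`
  have hv : ((pp : ℕ) : 𝓞 F) ∈ v₀.asIdeal := natCast_mem_placeOf X pp x₀
  obtain ⟨hfinrank, ϖ₁, hϖ₁, hsq₁⟩ := exists_uniformizer_sq (pp : ℕ) v₀ hv he hf
  let ϖ : Kˣ := ϖ₁
  have hϖ : IsUniformizer ϖ := hϖ₁
  have hsq : ‖(ϖ : K)‖ ^ 2 = ((pp : ℕ) : ℝ)⁻¹ := hsq₁
  obtain ⟨φK, hφc, hφc', -, hfixK, hmovK⟩ := IsmDHMover.exists_swap_parity (K := K) hsq hfinrank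
  -- the identity `Carrier (.inr v₀) ≃ K_v₀^{(1/n)}` and the shell as a ball
  let e : Carrier (.inr v₀ : Place F) ≃+* K := RescaledCompletion.of F pp v₀ hv
  have hshell : shell (analyticLogv F) (.inr v₀) = e.symm '' closedBall (0 : K) ‖(ϖ : K)‖⁻¹ :=
    shell_analyticLogv_eq_image_closedBall (pp : ℕ) v₀ hv hres h5 he hϖ
  -- the mover on the carrier
  let ψa : Carrier (.inr v₀ : Place F) ≃+ Carrier (.inr v₀ : Place F) :=
    (e.toAddEquiv.trans φK.toAddEquiv).trans e.symm.toAddEquiv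
  let ψ : Carrier (.inr v₀ : Place F) ≃ₗ[ℚ] Carrier (.inr v₀ : Place F) :=
    { ψa with map_smul' := fun q x => map_rat_smul ψa q x }
  have hψ : ∀ x, ψ x = e.symm (φK (e x)) := fun x => rfl
  have hψimg : ∀ S : Set K, ⇑ψ '' (e.symm '' S) = e.symm '' (⇑φK '' S) := by
    intro S
    ext y
    simp only [Set.mem_image, hψ]
    constructor
    · rintro ⟨x, ⟨z, hz, rfl⟩, rfl⟩
      exact ⟨φK z, ⟨z, hz, rfl⟩, by simp only [RingEquiv.apply_symm_apply]⟩
    · rintro ⟨w, ⟨z, hz, rfl⟩, rfl⟩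
      exact ⟨e.symm z, ⟨z, hz, rfl⟩, by simp only [RingEquiv.apply_symm_apply]⟩
  have hψmem : ψ ∈ ismDH (analyticLogv F) (.inr v₀ : Place F) := by
    refine ⟨hφc, hφc', ?_⟩
    have h := hfixK 0
    rw [show (2 : ℤ) * 0 - 1 = -1 by norm_num, zpow_neg_one] at h
    rw [hshell, hψimg, h]
  -- the unit ball `B := e⁻¹ B(0, ‖ϖ‖^{2·0})` is MOVED by `ψ`
  set Bc : Set (Carrier (.inr v₀ : Place F)) := e.symm '' closedBall (0 : K) (‖(ϖ : K)‖ ^ (2 * (0 : ℤ)))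
    with hBc
  have hmem_Bc : ∀ z : Carrier (.inr v₀ : Place F), z ∈ Bc ↔ ‖e z‖ ≤ ‖(ϖ : K)‖ ^ (2 * (0 : ℤ)) := by
    intro z
    rw [hBc]
    constructor
    · rintro ⟨w, hw, rfl⟩
      rw [RingEquiv.apply_symm_apply]; exact mem_closedBall_zero_iff.mp hw
    · intro hz
      exact ⟨e z, mem_closedBall_zero_iff.mpr hz, e.symm_apply_apply z⟩
  have hψBc : ⇑ψ '' Bc ≠ Bc := by
    rw [hBc, hψimg]
    intro h
    exact hmovK 0 (e.symm.injective.image_injective h)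
  -- the (Ind2)-generator: `ψ` at `v₀`, the identity elsewhere
  let gPl : ∀ y : Place F, Carrier y ≃ₗ[ℚ] Carrier y := fun y =>
    if h : y = .inr v₀ then (by subst h; exact ψ) else LinearEquiv.refl ℚ (Carrier y)
  have hgPl_v₀ : gPl (.inr v₀) = ψ := by
    show (if h : (Sum.inr v₀ : Place F) = .inr v₀ then _ else _) = ψ
    rw [dif_pos rfl]
  have hgPl_ne : ∀ y : Place F, y ≠ .inr v₀ → gPl y = LinearEquiv.refl ℚ (Carrier y) := by
    intro y hy
    show (if h : y = .inr v₀ then _ else _) = _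
    rw [dif_neg hy]
  have hgPl_mem : ∀ y : Place F, gPl y ∈ ismDH (analyticLogv F) y := by
    intro y
    by_cases hy : y = .inr v₀
    · subst hy; rw [hgPl_v₀]; exact hψmem
    · rw [hgPl_ne y hy]; exact refl_mem_ismDH _ y
  let Φ₀ : L.PacketAut := fun j vQ => L.factorwise j vQ fun _ => L.summandwise vQ fun v => gPl v.1
  have hΦ₀ : Φ₀ ∈ L.Ind2Family := fun j vQ =>
    ⟨fun _ v => gPl v.1, fun _ v => hgPl_mem v.1, rfl⟩
  refine ⟨Φ₀, hΦ₀, ?_, ?_⟩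
  · -- (a) star-triviality off `p₀`: every summand over `v_ℚ ≠ p₀` is a place `≠ v₀`
    intro v hover
    apply LinearEquiv.ext
    intro x
    funext j'
    show (Φ₀ j'.1 ((thetaIndex X).over v)) (x j') = x j'
    have hw : ∀ w : (thetaIndex X).Fibre ((thetaIndex X).over v), gPl w.1 = LinearEquiv.refl ℚ (Carrier w.1) := by
      intro w
      refine hgPl_ne w.1 fun hw1 => hover ?_
      rw [← w.2, hw1, hv₀]
    have hΦv : Φ₀ j'.1 ((thetaIndex X).over v) = LinearEquiv.refl ℚ _ := by
      show L.factorwise j'.1 ((thetaIndex X).over v)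
          (fun _ => L.summandwise ((thetaIndex X).over v) fun w => gPl w.1) = _
      have hg : (fun w : (thetaIndex X).Fibre ((thetaIndex X).over v) => gPl w.1) =
          fun w : (thetaIndex X).Fibre ((thetaIndex X).over v) => LinearEquiv.refl ℚ (L.carrier w.1) := by
        funext w; exact hw w
      rw [hg, L.summandwise_refl_family, L.factorwise_refl]
    rw [hΦv]
    rfl
  · -- (b) the label-0 Θ-region at `(0, p₀)` is moved
    intro m
    -- the region, in the real prime packet: `comparison⁻¹ Π_{v⃗} ι_last(1)·(R_I)^∼`
    have hR : (settingDHVolSharp X hlog M archPk archSub Ψ act Mmod region n lat sig split qData tq t htq0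
          htq1).thetaRegion m 0 (.inr pp) =
        P.comparison 0 ⁻¹' Set.pi univ fun ev =>
          iota pp.1 (P.kk ev) (Fin.last _) (labelIdele X t pp 0 (ev (Fin.last _))) •
            (normalizedPacket pp.1 (P.kk ev) : Set (P.X ev)) := by
      change (fun x => P.factorMap 0 x) ⁻¹' P.boxOf (sharpBoxDH X hlog t pp 0) = _
      rw [P.factorMap_preimage_boxOf]
      rfl
    rw [hR]
    have hc1 : ∀ x : (thetaIndex X).Fibre (.inr pp), labelIdele X t pp 0 x = 1 := labelIdele_zero X t pp
    have hc0 : ∀ x : (thetaIndex X).Fibre (.inr pp), labelIdele X t pp 0 x ≠ 0 := fun x => by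
      rw [hc1]; exact one_ne_zero
    have hck : ‖labelIdele X t pp 0 x₀‖ = ‖(ϖ : K)‖ ^ (2 * (0 : ℤ)) := by
      rw [hc1, norm_one, mul_zero, zpow_zero]
    -- test vectors: for `z ∈ K_{v₀}` the pure tensor with `z` at `v₀` and `1` elsewhere (one tensor slot at label 0)
    let y1 : Carrier (.inr v₀ : Place F) → L.Packet1 (.inr pp) := fun z =>
      Function.update (fun v => (P.φ v).symm (labelIdele X t pp 0 v)) x₀ z
    have hy1_x₀ : ∀ z, y1 z x₀ = z := fun z => Function.update_self _ _ _
    have hy1_ne : ∀ z (v : (thetaIndex X).Fibre (.inr pp)), v ≠ x₀ →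
        y1 z v = (P.φ v).symm (labelIdele X t pp 0 v) :=
      fun z v hv' => Function.update_of_ne hv' _ _
    let xz : Carrier (.inr v₀ : Place F) → L.Packet 0 (.inr pp) := fun z => L.tprod 0 (.inr pp) fun _ => y1 z
    -- membership of the test vectors: decided at the constant tuple `v⃗ = (v₀)`, where it reads `‖z‖ ≤ 1`
    have hφx₀ : ∀ z : Carrier (.inr v₀ : Place F), P.φ x₀ z = e z := fun z => rfl
    have hall : ∀ z, ‖e z‖ ≤ ‖(ϖ : K)‖ ^ (2 * (0 : ℤ)) →
        ∀ v : (thetaIndex X).Fibre (.inr pp), ‖P.φ v (y1 z v)‖ ≤ ‖labelIdele X t pp 0 v‖ := by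
      intro z hz v
      by_cases hv' : v = x₀
      · subst hv'
        rw [hy1_x₀, hφx₀]
        exact hz.trans_eq hck.symm
      · rw [hy1_ne z v hv', LinearEquiv.apply_symm_apply]
        exact le_rfl
    have hmem_xz : ∀ z, xz z ∈ P.comparison 0 ⁻¹' (Set.pi univ fun ev =>
        iota pp.1 (P.kk ev) (Fin.last _) (labelIdele X t pp 0 (ev (Fin.last _))) •
          (normalizedPacket pp.1 (P.kk ev) : Set (P.X ev))) ↔ z ∈ Bc := by
      intro z
      rw [hmem_Bc, Set.mem_preimage, Set.mem_univ_pi]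
      constructor
      · intro h
        have h0 := h (fun _ => x₀)
        rw [show P.comparison 0 (xz z) (fun _ => x₀) = _ from P.comparison_tprod 0 (fun _ => y1 z) (fun _ => x₀),
          IsmDHMover.tprod_eq_iota_last _ hlab,
          IsmDHMover.iota_mem_smul_normalizedPacket_iff pp.1 (P.kk fun _ => x₀) (Fin.last _) (hc0 x₀),
          hy1_x₀, hφx₀] at h0
        exact h0.trans_eq hck
      · intro hz ev
        rw [show P.comparison 0 (xz z) ev = _ from P.comparison_tprod 0 (fun _ => y1 z) ev,
          IsmDHMover.tprod_eq_iota_last _ hlab,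
          IsmDHMover.iota_mem_smul_normalizedPacket_iff pp.1 (P.kk ev) (Fin.last _) (hc0 (ev (Fin.last _)))]
        exact hall z hz (ev (Fin.last _))
    -- the generator acts on the test vectors by `ψ` at `v₀`
    have hΦxz : ∀ z, Φ₀ 0 (.inr pp) (xz z) = xz (ψ z) := by
      intro z
      show L.factorwise 0 (.inr pp) (fun _ => L.summandwise (.inr pp) fun v => gPl v.1)
          (L.tprod 0 (.inr pp) fun _ => y1 z) = L.tprod 0 (.inr pp) fun _ => y1 (ψ z)
      rw [L.factorwise_summandwise_tprod]
      congr 1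
      funext a v
      by_cases hv' : v = x₀
      · rw [hv', hy1_x₀, hy1_x₀]
        show gPl (.inr v₀) z = ψ z
        rw [hgPl_v₀]
      · have hv1 : v.1 ≠ .inr v₀ := fun h => hv' (Subtype.ext h)
        rw [hy1_ne z _ hv', hy1_ne (ψ z) _ hv', hgPl_ne v.1 hv1]
        rfl
    intro hEq
    have key : ∀ x, x ∈ _ ↔ Φ₀ 0 (.inr pp) x ∈ _ := fun x =>
      ((Φ₀ 0 (.inr pp)).injective.mem_set_image).symm.trans (Set.ext_iff.mp hEq (Φ₀ 0 (.inr pp) x))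
    rcases IsmDHMover.exists_of_image_ne ψ.toEquiv hψBc with ⟨z, hz, hψz⟩ | ⟨z, hz, hψz⟩
    · -- `z ∈ B`, `ψ z ∉ B`: `x_z` lies in the region, `Φ₀ x_z = x_{ψ z}` does not
      have h1 : Φ₀ 0 (.inr pp) (xz z) ∈ _ := (key (xz z)).mp ((hmem_xz z).mpr hz)
      have h2 := (hΦxz z) ▸ h1
      exact hψz ((hmem_xz (ψ z)).mp h2)
    · -- `z ∉ B`, `ψ z ∈ B`: `x_{ψ z} = Φ₀ x_z` lies in the (Φ₀-stable) region, so `x_z` does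
      have h1 : xz (ψ z) ∈ _ := (hmem_xz (ψ z)).mpr hψz
      have h2 := (hΦxz z).symm ▸ h1
      exact hz ((hmem_xz z).mp ((key (xz z)).mpr h2))

/-! ## §3. The Θ-pin is unsatisfiable at the sharp real setting -/

variable (col : ℤ → Column (logShellsDH X (analyticLogv F)))
  (ρ : (∀ v : (thetaIndex X).V, v ∈ (thetaIndex X).Vbad → Set ((logShellsDH X (analyticLogv F)).StarPacket v)) →
    ∀ (j : (thetaIndex X).Label) (vQ : (thetaIndex X).VQ), Set ((logShellsDH X (analyticLogv F)).Packet j vQ))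
  (qK : ∀ v : (thetaIndex X).V, v ∈ (thetaIndex X).Vbad → Set ((logShellsDH X (analyticLogv F)).StarPacket v))

/-- **PR-1's Θ-PIN FAILS, FOR EVERY region-forming operator `ρ`, at the SHARP assembled real setting of record**
(`Real.settingDHVolSharp`, analytic logarithms, any ideles/context binders/columns) as soon as `F` has one tame
quadratically ramified place `v₀` (`e = 2`, `f = 1`) over a prime `p₀ ≥ 5` with NO place of `S` over `p₀`: the one-place
DH (Ind2) mover at `v₀` fixes every bad-place star packet but moves the label-`0` Θ-region at `(0, p₀)`.
[cite: DupuyHilado2025, §4.9] [claim: Mochizuki2012, status: disputed] -/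
theorem not_thetaPinned_settingDHVolSharp
    (pp : Nat.Primes) (h5 : 5 ≤ (pp : ℕ)) (v₀ : HeightOneSpectrum (𝓞 F))
    (hv₀ : (thetaIndex X).over (.inr v₀) = .inr pp)
    (he : v₀.asIdeal.ramificationIdx ℤ = 2) (hf : v₀.asIdeal.inertiaDeg ℤ = 1)
    (hS : ∀ v ∈ (thetaIndex X).Vbad, (thetaIndex X).over v ≠ .inr pp) :
    ¬ ThetaPinned
        ({ toSituation := situationDHVol X (logvAnalytic_analyticLogv (F := F)) M archPk archSub Ψ act Mmod region,
           col := col } : LatticeSituation (thetaIndex X))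
        (settingDHVolSharp X (logvAnalytic_analyticLogv (F := F)) M archPk archSub Ψ act Mmod region n lat sig
          split qData tq t htq0 htq1) ρ := by
  intro hpin
  obtain ⟨Φ₀, hΦ₀, hstar, hmov⟩ :=
    exists_ind2_starTrivial_moves_thetaRegion_zero_settingDHVolSharp X M archPk archSub Ψ act Mmod region n lat
      sig split qData tq t htq0 htq1 pp h5 v₀ hv₀ he hf
  refine hmov 0 (Cor312Vol.image_thetaRegion_eq_of_thetaPinned hpin
    (Subgroup.subset_closure (Set.mem_union_right _ hΦ₀)) ?_ 0 0 (.inr pp))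
  intro v hv A
  have h := hstar v (hS v hv)
  change ⇑((logShellsDH X (analyticLogv F)).starAut Φ₀ v) '' A = A
  rw [h]
  exact Set.image_id' A

/-- … hence PR-1's two pins `PinnedRegions` (Θ-pin ∧ q-pin) fail there for every `ρ`, `qK`. [claim: Mochizuki2012, status: disputed] -/
theorem not_pinnedRegions_settingDHVolSharp
    (pp : Nat.Primes) (h5 : 5 ≤ (pp : ℕ)) (v₀ : HeightOneSpectrum (𝓞 F))
    (hv₀ : (thetaIndex X).over (.inr v₀) = .inr pp)
    (he : v₀.asIdeal.ramificationIdx ℤ = 2) (hf : v₀.asIdeal.inertiaDeg ℤ = 1)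
    (hS : ∀ v ∈ (thetaIndex X).Vbad, (thetaIndex X).over v ≠ .inr pp) :
    ¬ PinnedRegions
        ({ toSituation := situationDHVol X (logvAnalytic_analyticLogv (F := F)) M archPk archSub Ψ act Mmod region,
           col := col } : LatticeSituation (thetaIndex X))
        (settingDHVolSharp X (logvAnalytic_analyticLogv (F := F)) M archPk archSub Ψ act Mmod region n lat sig
          split qData tq t htq0 htq1) ρ qK := fun h =>
  not_thetaPinned_settingDHVolSharp X M archPk archSub Ψ act Mmod region n lat sig split qData tq t htq0 htq1 col ρ pp
    h5 v₀ hv₀ he hf hS h.1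

/-- … and so does `PinnedRegions3` (two pins ∧ link pin) — branch C's `hPin` binder, AT this setting. [claim: Mochizuki2012, status: disputed] -/
theorem not_pinnedRegions3_settingDHVolSharp
    (pp : Nat.Primes) (h5 : 5 ≤ (pp : ℕ)) (v₀ : HeightOneSpectrum (𝓞 F))
    (hv₀ : (thetaIndex X).over (.inr v₀) = .inr pp)
    (he : v₀.asIdeal.ramificationIdx ℤ = 2) (hf : v₀.asIdeal.inertiaDeg ℤ = 1)
    (hS : ∀ v ∈ (thetaIndex X).Vbad, (thetaIndex X).over v ≠ .inr pp) :
    ¬ PinnedRegions3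
        ({ toSituation := situationDHVol X (logvAnalytic_analyticLogv (F := F)) M archPk archSub Ψ act Mmod region,
           col := col } : LatticeSituation (thetaIndex X))
        (settingDHVolSharp X (logvAnalytic_analyticLogv (F := F)) M archPk archSub Ψ act Mmod region n lat sig
          split qData tq t htq0 htq1) ρ qK := fun h =>
  not_pinnedRegions_settingDHVolSharp X M archPk archSub Ψ act Mmod region n lat sig split qData tq t htq0 htq1 col ρ
    qK pp h5 v₀ hv₀ he hf hS h.1

/-- The hypothesis «no place of `S` over `p₀`» from the concrete form `∀ v ∈ S, residueChar F v ≠ p₀`. [folklore] -/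
theorem over_ne_of_residueChar_ne (pp : Nat.Primes) (hS : ∀ v ∈ X.S, residueChar F v ≠ (pp : ℕ)) :
    ∀ v ∈ (thetaIndex X).Vbad, (thetaIndex X).over v ≠ .inr pp := by
  rintro _ ⟨v, hv, rfl⟩ h
  have h' : residueChar F v = (pp : ℕ) := congrArg Subtype.val (Sum.inr.inj h)
  exact hS v hv h'

end Assembled

end Thm311.Real

end Summit.ABC.IUTFork

end
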